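import Summits.AnomalousDissipation.AnomalousDissipation.Theorems.MarginalStabilityChainStrainedLayerLawParallelRelaxMember
import Summits.AnomalousDissipation.AnomalousDissipation.Theorems.MarginalStabilityChainStrainedLayerLawParallelRelaxStubCesaro
import Summits.AnomalousDissipation.AnomalousDissipation.Theorems.MarginalStabilityChainStrainedLayerLawParallelRelaxStubHeatGradient
import HarnessLib
import Summits.AnomalousDissipation.AnomalousDissipation.Theorems.MarginalStabilityChainStrainedLayerLawParallelRelaxStubTools

/-!
# Crux `MarginalStabilityChain.StrainedLayerLaw` (stmt-AnomalousDissipation-3007), line `FirstLemmasR2K4`: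
# x-INDEPENDENT PERTURBATIONS RELAX TO THE SWEET–PARKER RUNG — the crux restricted to them is FALSE

Support file (`--supports stmt-AnomalousDissipation-3007`; registered sub-goals `parallelMember_meanLayerDissipation` and
`strainedLayerLaw_xIndependent_false`). Line lead c5 (`prover-line-stmt-AnomalousDissipation-3007-c5-0`, 2026-08-16).
Second half of the PARALLEL-RELAXATION package (first half: `…ParallelRelaxMember.lean`, the member `U_B + P`). No definitions:
file-local notations `sclock[ν,t]`, `sdiff[ν,g,t,y]`, `pdiss[ν,g,t]` abbreviate the explicit formulas.

* `pdiss[ν, g, t] = ν∫(U_B′ + eᵗ(e^{s(t)Δ}g)′(eᵗ·))²` is the crux's dissipation functional on the parallel member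
  (`layerDissipation_member`, via the landed `stub_parallelClassTools`); it is bounded on `(0, ∞)` (`pdiss_le`) and
  RELAXES to the laminar value `ν∫(U_B′)² = √ν/(2√π)` (`tendsto_pdiss`): `∫(eᵗh′(eᵗy))²dy = eᵗ‖h′‖₂²` with the
  gradient of the 1-D caloric extension controlled by the landed `stub_heatGradientL2Line` (p129512: contraction near
  `t = 0`, `L¹ → L²` smoothing `≲ s^{-3/2}` for large `t`) and the clock decay `eᵗ s(t)^{-3/2} → 0` (`stub_parallelRelaxTools`);
* `parallelMember_meanLayerDissipation` (REGISTERED): for every `ν > 0`, `L > 0` and every admissible x-INDEPENDENT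
  `θ` the class `InCruxClass ν L θ₁ θ₂` has a member whose `meanLayerDissipation` is EXACTLY `ofReal (√ν/(2√π))`
  (Cesàro step: landed `stub_cesaroMean`, p129434);
* `strainedLayerLaw_xIndependent_false` (REGISTERED NEGATIVE): hence the crux with its `∃ θ₁ θ₂` restricted by the extra
  clause `∀ x y, θ₁ x y = θ₁ 0 y ∧ θ₂ x y = θ₂ 0 y` is FALSE for every `c > 0` (take `L = 1`, `ν = min ν₀ (πc²)`):
  the unconditional, importable form of `Disproof.lean` §4 (`lawAt_parallel_false_of_relaxation`, there conditional on
  `ParallelRelaxes`, discharged in §4b only for the non-admissible Gaussian-tailed thick-layer datum). CONSEQUENCE for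
  the line: the witness `θ` of the crux and of `stub_roundnessFloor` must depend on `x` (KH roll-up is the only road).

No facts are asserted. References: Majda–Bertozzi 2002 §1.4 (1.34); the disprover's workfile §2/§4; tree files named above.
-/

noncomputable section

open scoped Topology ENNReal
open Filter Set Function MeasureTheory

-- `Summit.<Summit>.<Problem>` is the tree's mandated summit-side namespace (CONVENTIONS §2); for this
-- single-conjunct summit the two coincide, so the duplicate is deliberate.
set_option linter.dupNamespace false

namespace Summit.AnomalousDissipation.AnomalousDissipation.Theorems.StrainedLayerLaw.ParallelRelax

open Literature.Analysis.FluidPDE Literature.Analysis.FluidPDE.StretchedLayer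
open Literature.Analysis.UnboundedOperators
open Summit.AnomalousDissipation.AnomalousDissipation.Theses.MarginalStabilityChain
open Summit.AnomalousDissipation.AnomalousDissipation.Theorems.StrainedLayerLaw.StrainWorkSumRule

/-! File-local NOTATION (no definitions; as in `…ParallelRelaxMember.lean`):
* `sclock[ν, t] = ν(e^{2t} − 1)/2`, `sdiff[ν, g, t, y] = ∫ G₁(z) g(eᵗy − √sclock·z) dz` (the strained shear diffusion);
* `pdiss[ν, g, t] = ν ∫ (U_B′(y) + eᵗ (e^{s(t)Δ}g)′(eᵗy))² dy` — the real slice dissipation of the parallel member for `t > 0`. -/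
local notation3 (prettyPrint := false) "sclock[" ν ", " t "]" => ν * (Real.exp (2 * t) - 1) / 2
local notation3 (prettyPrint := false) "sdiff[" ν ", " g ", " t ", " y "]" =>
  ∫ z, heatKernel 1 z * g (Real.exp t * y - Real.sqrt (ν * (Real.exp (2 * t) - 1) / 2) * z)
local notation3 (prettyPrint := false) "pdiss[" ν ", " g ", " t "]" =>
  ν * ∫ y, (burgersLayerProfileD 1 ν 1 y +
    Real.exp t * deriv (heatExtension g (ν * (Real.exp (2 * t) - 1) / 2)) (Real.exp t * y)) ^ 2

/-! ### The dissipation of the parallel member relaxes to the Sweet–Parker rung -/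

section Dissipation

variable {ν : ℝ} {g : ℝ → ℝ}

/-- `U_B′` is continuous. [folklore] -/
theorem continuous_bLPD (ν : ℝ) : Continuous (burgersLayerProfileD 1 ν 1) :=
  continuous_iff_continuousAt.2 fun s => (hasDerivAt_burgersLayerProfileD 1 ν 1 s).continuousAt

/-- The `y`-derivative of the member's slice for `t > 0`: `U_B′(y) + eᵗ(e^{s(t)Δ}g)′(eᵗy)`, as a function. [folklore] -/
theorem deriv_member_slice (hν : 0 < ν) (hg : ContDiff ℝ 2 g) (hc : HasCompactSupport g) {t : ℝ}
    (ht : 0 < t) :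
    deriv (fun s => burgersLayerProfile 1 ν 1 s + sdiff[ν, g, t, s]) = fun s => burgersLayerProfileD 1 ν 1 s +
      Real.exp t * deriv (heatExtension g (ν * (Real.exp (2 * t) - 1) / 2)) (Real.exp t * s) := by
  have hPd : Differentiable ℝ (fun s => sdiff[ν, g, t, s]) :=
    (contDiff_sdiff_slice hν hg hc ht).differentiable (by norm_num)
  funext s
  have h1 : deriv (fun s => burgersLayerProfile 1 ν 1 s + sdiff[ν, g, t, s]) s =
      burgersLayerProfileD 1 ν 1 s + deriv (fun s => sdiff[ν, g, t, s]) s :=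
    ((hasDerivAt_burgersLayerProfile' 1 ν 1 s).add (hPd s).hasDerivAt).deriv
  rw [h1, deriv_sdiff_slice hν ht]

/-- The perturbation gradient `b_t(y) = eᵗ(e^{s(t)Δ}g)′(eᵗy)` is square integrable with
`∫ b_t² = eᵗ ∫ ((e^{s(t)Δ}g)′)²`, and the latter obeys the contraction and the smoothing bounds. [folklore] -/
theorem perturbationGradient_sq (hν : 0 < ν) (hg : ContDiff ℝ 2 g) (hc : HasCompactSupport g) {t : ℝ}
    (ht : 0 < t) :
    Integrable (fun y => (Real.exp t *
        deriv (heatExtension g (ν * (Real.exp (2 * t) - 1) / 2)) (Real.exp t * y)) ^ 2) ∧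
      ∫ y, (Real.exp t * deriv (heatExtension g (ν * (Real.exp (2 * t) - 1) / 2)) (Real.exp t * y)) ^ 2 =
        Real.exp t * ∫ x, deriv (heatExtension g (ν * (Real.exp (2 * t) - 1) / 2)) x ^ 2 := by
  have hA := (stub_heatGradientL2Line.1 g _ hg hc (sclock_pos hν ht)).1
  exact stub_parallelRelaxTools.2.2.1 _ (Real.exp t) (Real.exp_pos t) hA

/-- **The crux's dissipation functional on the parallel member** (`t > 0`, `L > 0`):
`layerDissipation ν L (u t) 0 = ofReal (d t)`. [folklore] -/
theorem layerDissipation_member (hν : 0 < ν) {L : ℝ} (hL : 0 < L) (hg : ContDiff ℝ 2 g)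
    (hc : HasCompactSupport g) {t : ℝ} (ht : 0 < t) :
    layerDissipation ν L (fun _ y => burgersLayerProfile 1 ν 1 y + sdiff[ν, g, t, y]) (fun _ _ => 0) =
      ENNReal.ofReal (pdiss[ν, g, t]) := by
  have hb := perturbationGradient_sq hν hg hc ht
  have hcontb : Continuous fun y => Real.exp t *
      deriv (heatExtension g (ν * (Real.exp (2 * t) - 1) / 2)) (Real.exp t * y) :=
    continuous_const.mul (((contDiff_heatExtension_of_hasCompactSupport hg hc _).continuous_deriv
      (by norm_num)).comp (continuous_const.mul continuous_id))
  have hsum := (stub_parallelRelaxTools.2.1 _ _ 1 one_pos (continuous_bLPD ν) hcontb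
    (integrable_burgersLayerProfileD_sq one_pos hν 1) hb.1).1
  have hint : Integrable fun y => deriv (fun s => burgersLayerProfile 1 ν 1 s + sdiff[ν, g, t, s]) y ^ 2 := by
    rw [deriv_member_slice hν hg hc ht]; exact hsum
  have h := stub_parallelClassTools.2.1 ν L (fun s => burgersLayerProfile 1 ν 1 s + sdiff[ν, g, t, s]) hν.le hL hint
  rw [deriv_member_slice hν hg hc ht] at h
  exact h

/-- `d(t) ≥ 0`. [folklore] -/
theorem pdiss_nonneg (hν : 0 ≤ ν) (g : ℝ → ℝ) (t : ℝ) : 0 ≤ pdiss[ν, g, t] :=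
  mul_nonneg hν (integral_nonneg fun _ => sq_nonneg _)

/-- The laminar value: `ν ∫ (U_B′)² = √ν/(2√π)`. [folklore] -/
theorem nu_mul_integral_bLPD_sq_one (hν : 0 < ν) :
    ν * ∫ y, burgersLayerProfileD 1 ν 1 y ^ 2 = Real.sqrt ν / (2 * Real.sqrt Real.pi) := by
  have h := nu_mul_integral_burgersLayerProfileD_sq one_pos hν (1:ℝ)
  simpa using h

/-- **Uniform bound**: `d(t) ≤ M` for all `t > 0` (contraction near `t = 0`, smoothing for large `t`). [folklore] -/
theorem pdiss_le (hν : 0 < ν) (hg : ContDiff ℝ 2 g) (hc : HasCompactSupport g) :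
    ∃ M : ℝ, ∀ t : ℝ, 0 < t → pdiss[ν, g, t] ≤ M := by
  obtain ⟨C, hC0, hC⟩ := stub_heatGradientL2Line.2
  set A : ℝ := ∫ y, burgersLayerProfileD 1 ν 1 y ^ 2 with hA
  set G1 : ℝ := (∫ x, |g x|) ^ 2 with hG1
  set G2 : ℝ := ∫ x, deriv g x ^ 2 with hG2
  -- the clock factor `eᵗ s(t)^{-3/2}` is eventually ≤ 1
  have hclock := stub_parallelRelaxTools.2.2.2 ν hν
  obtain ⟨T₁, hT₁⟩ := (Filter.eventually_atTop.1 ((hclock.eventually (gt_mem_nhds one_pos)).and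
    (eventually_ge_atTop 1)))
  refine ⟨2 * ν * A + 2 * ν * max (Real.exp T₁ * G2) (C * G1), fun t ht => ?_⟩
  have hb := perturbationGradient_sq hν hg hc ht
  have hcontb : Continuous fun y => Real.exp t *
      deriv (heatExtension g (ν * (Real.exp (2 * t) - 1) / 2)) (Real.exp t * y) :=
    continuous_const.mul (((contDiff_heatExtension_of_hasCompactSupport hg hc _).continuous_deriv
      (by norm_num)).comp (continuous_const.mul continuous_id))
  have hsum := (stub_parallelRelaxTools.2.1 _ _ 1 one_pos (continuous_bLPD ν) hcontb
    (integrable_burgersLayerProfileD_sq one_pos hν 1) hb.1).2.1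
  -- the perturbation part
  set B : ℝ := ∫ x, deriv (heatExtension g (ν * (Real.exp (2 * t) - 1) / 2)) x ^ 2 with hB
  have hB0 : 0 ≤ B := integral_nonneg fun _ => sq_nonneg _
  have hσ : 0 < ν * (Real.exp (2 * t) - 1) / 2 := sclock_pos hν ht
  have hBle : Real.exp t * B ≤ max (Real.exp T₁ * G2) (C * G1) := by
    rcases le_or_gt T₁ t with hle | hlt
    · -- large time: smoothing
      have h1 : B ≤ C * (ν * (Real.exp (2 * t) - 1) / 2) ^ (-(3 / 2 : ℝ)) * G1 := hC g _ hg hc hσ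
      have h2 := (hT₁ t hle).1
      have h3 : Real.exp t * B ≤ C * G1 * (Real.exp t * (ν * (Real.exp (2 * t) - 1) / 2) ^ (-(3 / 2 : ℝ))) := by
        have := mul_le_mul_of_nonneg_left h1 (Real.exp_pos t).le
        linarith [this]
      have h4 : C * G1 * (Real.exp t * (ν * (Real.exp (2 * t) - 1) / 2) ^ (-(3 / 2 : ℝ))) ≤ C * G1 * 1 :=
        mul_le_mul_of_nonneg_left h2.le (by positivity)
      exact le_max_of_le_right (by linarith)
    · -- short time: contraction
      have h1 : B ≤ G2 := (stub_heatGradientL2Line.1 g _ hg hc hσ).2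
      have h2 : Real.exp t ≤ Real.exp T₁ := Real.exp_le_exp.2 hlt.le
      have hG2 : 0 ≤ G2 := integral_nonneg fun _ => sq_nonneg _
      exact le_max_of_le_left (mul_le_mul h2 h1 hB0 (Real.exp_pos T₁).le)
  rw [hb.2] at hsum
  have hν' := hν.le
  nlinarith [hsum, hBle, mul_le_mul_of_nonneg_left hsum hν']

/-- **Relaxation**: `d(t) → √ν/(2√π)` as `t → ∞`. [folklore] -/
theorem tendsto_pdiss (hν : 0 < ν) (hg : ContDiff ℝ 2 g) (hc : HasCompactSupport g) :
    Tendsto (fun t => pdiss[ν, g, t]) atTop (𝓝 (Real.sqrt ν / (2 * Real.sqrt Real.pi))) := by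
  obtain ⟨C, hC0, hC⟩ := stub_heatGradientL2Line.2
  set A : ℝ := ∫ y, burgersLayerProfileD 1 ν 1 y ^ 2 with hA
  set G1 : ℝ := (∫ x, |g x|) ^ 2 with hG1
  have hA0 : 0 ≤ A := integral_nonneg fun _ => sq_nonneg _
  have hG10 : 0 ≤ G1 := sq_nonneg _
  have hK : ν * A = Real.sqrt ν / (2 * Real.sqrt Real.pi) := nu_mul_integral_bLPD_sq_one hν
  rw [← hK, Metric.tendsto_atTop]
  intro ε hε
  -- choose δ with ν δ A ≤ ε/2, then t large
  set δ : ℝ := ε / (2 * (ν * A + 1)) with hδ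
  have hνA : 0 < ν * A + 1 := by positivity
  have hδpos : 0 < δ := by positivity
  have hδA : ν * (δ * A) < ε / 2 := by
    have : ν * (δ * A) = ε / 2 * (ν * A / (ν * A + 1)) := by
      rw [hδ]; field_simp
    rw [this]
    have h1 : ν * A / (ν * A + 1) < 1 := by
      rw [div_lt_one hνA]; linarith
    have h2 : ε / 2 * (ν * A / (ν * A + 1)) < ε / 2 * 1 := mul_lt_mul_of_pos_left h1 (by linarith)
    linarith
  set η : ℝ := ε / (2 * (ν * (1 + 1 / δ) * (C * G1 + 1))) with hη
  have hco : 0 < ν * (1 + 1 / δ) * (C * G1 + 1) := by positivity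
  have hηpos : 0 < η := by positivity
  have hclock := stub_parallelRelaxTools.2.2.2 ν hν
  obtain ⟨T, hT⟩ := Filter.eventually_atTop.1 ((hclock.eventually (gt_mem_nhds hηpos)).and
    (eventually_gt_atTop 0))
  refine ⟨T, fun t hle => ?_⟩
  obtain ⟨hcl, ht⟩ := hT t hle
  have hb := perturbationGradient_sq hν hg hc ht
  have hcontb : Continuous fun y => Real.exp t *
      deriv (heatExtension g (ν * (Real.exp (2 * t) - 1) / 2)) (Real.exp t * y) :=
    continuous_const.mul (((contDiff_heatExtension_of_hasCompactSupport hg hc _).continuous_deriv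
      (by norm_num)).comp (continuous_const.mul continuous_id))
  have hδb := (stub_parallelRelaxTools.2.1 _ _ δ hδpos (continuous_bLPD ν) hcontb
    (integrable_burgersLayerProfileD_sq one_pos hν 1) hb.1).2.2
  rw [hb.2] at hδb
  set B : ℝ := ∫ x, deriv (heatExtension g (ν * (Real.exp (2 * t) - 1) / 2)) x ^ 2 with hB
  have hB0 : 0 ≤ B := integral_nonneg fun _ => sq_nonneg _
  have hσ : 0 < ν * (Real.exp (2 * t) - 1) / 2 := sclock_pos hν ht
  have hclock0 : 0 ≤ Real.exp t * (ν * (Real.exp (2 * t) - 1) / 2) ^ (-(3 / 2 : ℝ)) := by positivity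
  -- `eᵗ B ≤ C G1 · (eᵗ s^{-3/2}) < (C G1 + 1) η`
  have h1 : Real.exp t * B ≤ C * G1 * (Real.exp t * (ν * (Real.exp (2 * t) - 1) / 2) ^ (-(3 / 2 : ℝ))) := by
    have := mul_le_mul_of_nonneg_left (hC g _ hg hc hσ) (Real.exp_pos t).le
    linarith [this]
  have h2 : Real.exp t * B ≤ (C * G1 + 1) * η := by
    have : C * G1 * (Real.exp t * (ν * (Real.exp (2 * t) - 1) / 2) ^ (-(3 / 2 : ℝ))) ≤ (C * G1 + 1) * η :=
      mul_le_mul (by linarith) hcl.le hclock0 (by positivity)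
    linarith
  have h3 : ν * ((1 + 1 / δ) * (Real.exp t * B)) ≤ ε / 2 := by
    have : ν * ((1 + 1 / δ) * ((C * G1 + 1) * η)) = ε / 2 := by
      rw [hη]; field_simp
    rw [← this]
    have h1δ : 0 ≤ 1 + 1 / δ := by positivity
    exact mul_le_mul_of_nonneg_left (mul_le_mul_of_nonneg_left h2 h1δ) hν.le
  rw [Real.dist_eq]
  rw [← mul_sub, abs_mul, abs_of_pos hν]
  calc ν * |(∫ y, (burgersLayerProfileD 1 ν 1 y + Real.exp t *
          deriv (heatExtension g (ν * (Real.exp (2 * t) - 1) / 2)) (Real.exp t * y)) ^ 2) - A|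
        ≤ ν * (δ * A + (1 + 1 / δ) * (Real.exp t * B)) := mul_le_mul_of_nonneg_left hδb hν.le
    _ = ν * (δ * A) + ν * ((1 + 1 / δ) * (Real.exp t * B)) := by ring
    _ < ε / 2 + ε / 2 := add_lt_add_of_lt_of_le hδA h3
    _ = ε := by ring

end Dissipation
/-! ## The parallel member (lead) -/

/-- The registered sub-goal (sharp form). [folklore] -/
theorem parallelMember_meanLayerDissipation :
    ∀ (ν L : ℝ) (θ₁ θ₂ : ℝ → ℝ → ℝ), 0 < ν → 0 < L → IsAdmissible L θ₁ θ₂ →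
      (∀ x y, θ₁ x y = θ₁ 0 y ∧ θ₂ x y = θ₂ 0 y) →
        ∃ u v p : ℝ → ℝ → ℝ → ℝ, InCruxClass ν L θ₁ θ₂ u v p ∧
          meanLayerDissipation ν L u v = ENNReal.ofReal (Real.sqrt ν / (2 * Real.sqrt Real.pi)) := by
  intro ν L θ₁ θ₂ hν hL hθ hx
  obtain ⟨hθ₂, hg, hc⟩ := stub_parallelClassTools.1 L θ₁ θ₂ hθ hx
  set g : ℝ → ℝ := θ₁ 0 with hgdef
  have hθ₁ : θ₁ = fun _ y => g y := funext fun x => funext fun y => (hx x y).1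
  have hθ₂' : θ₂ = fun _ _ => 0 := funext fun x => funext fun y => hθ₂ x y
  refine ⟨fun t _ y => burgersLayerProfile 1 ν 1 y + sdiff[ν, g, t, y], fun _ _ _ => 0, fun _ _ _ => 0, ?_, ?_⟩
  · rw [hθ₁, hθ₂']
    exact inCruxClass_parallel hν L hg hc
  · obtain ⟨M, hM⟩ := pdiss_le hν hg hc
    set d : ℝ → ℝ := fun t => if 0 < t then pdiss[ν, g, t] else 0 with hd
    have hd0 : ∀ t, 0 ≤ d t := fun t => by
      simp only [hd]
      split_ifs
      · exact pdiss_nonneg hν.le g t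
      · exact le_rfl
    have hdM : ∀ t, 0 < t → d t ≤ M := fun t ht => by
      simp only [hd, if_pos ht]
      exact hM t ht
    have hdK : Tendsto d atTop (𝓝 (Real.sqrt ν / (2 * Real.sqrt Real.pi))) := by
      refine (tendsto_pdiss hν hg hc).congr' ?_
      filter_upwards [eventually_gt_atTop 0] with t ht
      simp only [hd, if_pos ht]
    have hK0 : 0 ≤ Real.sqrt ν / (2 * Real.sqrt Real.pi) := by positivity
    have hces := stub_cesaroMean d _ M hK0 hd0 hdM hdK
    rw [meanLayerDissipation_def, ← hces]
    refine Filter.liminf_congr (Eventually.of_forall fun T => ?_)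
    congr 1
    refine setLIntegral_congr_fun measurableSet_Ioc fun t ht => ?_
    simp only [hd, if_pos ht.1]
    exact layerDissipation_member hν hL hg hc ht.1

/-- The registered sub-goal (crux-level negative). [folklore] -/
theorem strainedLayerLaw_xIndependent_false :
    ¬ ∃ c : ℝ, 0 < c ∧ ∀ L : ℝ, 0 < L → ∃ ν₀ : ℝ, 0 < ν₀ ∧ ∃ θ₁ θ₂ : ℝ → ℝ → ℝ,
      IsAdmissible L θ₁ θ₂ ∧ (∀ x y, θ₁ x y = θ₁ 0 y ∧ θ₂ x y = θ₂ 0 y) ∧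
      ∀ ν : ℝ, 0 < ν → ν ≤ ν₀ → ∀ (u v p : ℝ → ℝ → ℝ → ℝ), InCruxClass ν L θ₁ θ₂ u v p →
        ENNReal.ofReal (c * min L 1) ≤ meanLayerDissipation ν L u v := by
  rintro ⟨c, hc, h⟩
  obtain ⟨ν₀, hν₀, θ₁, θ₂, hθ, hx, hall⟩ := h 1 one_pos
  set ν : ℝ := min ν₀ (Real.pi * c ^ 2) with hνdef
  have hν : 0 < ν := lt_min hν₀ (by positivity)
  have hνle : ν ≤ ν₀ := min_le_left _ _
  obtain ⟨u, v, p, hmem, hD⟩ := parallelMember_meanLayerDissipation ν 1 θ₁ θ₂ hν one_pos hθ hx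
  have key := hall ν hν hνle u v p hmem
  rw [hD, min_self, mul_one, ENNReal.ofReal_le_ofReal_iff (by positivity)] at key
  have hsπ : 0 < Real.sqrt Real.pi := Real.sqrt_pos.2 Real.pi_pos
  have h1 : Real.sqrt ν ≤ Real.sqrt (Real.pi * c ^ 2) := Real.sqrt_le_sqrt (min_le_right _ _)
  have h2 : Real.sqrt (Real.pi * c ^ 2) = Real.sqrt Real.pi * c := by
    rw [Real.sqrt_mul Real.pi_pos.le, Real.sqrt_sq hc.le]
  have h3 : Real.sqrt ν / (2 * Real.sqrt Real.pi) ≤ c / 2 := by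
    rw [div_le_iff₀ (by positivity)]; nlinarith
  linarith


end Summit.AnomalousDissipation.AnomalousDissipation.Theorems.StrainedLayerLaw.ParallelRelax

end
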